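import Mathlib
import Summits.Ventures.PercRepro2.Defs
import Summits.Ventures.PercRepro2.Harris
import Summits.Ventures.PercRepro2.Graph
import Summits.Ventures.PercRepro2.Events
import Summits.Ventures.PercRepro2.Induced
import Summits.Ventures.PercRepro2.BHK
import Summits.Ventures.PercRepro2.BHKEvents
import Summits.Ventures.PercRepro2.VdBKahn
import Summits.Ventures.PercRepro2.BHKAvoid
import Summits.Ventures.PercRepro2.KPrimeReduction

/-!
# The base case of the `a₂`-frontier induction for `(K′)`: `KPrime.kprime_of_isolated`
(blind cell PercRepro2, mine-c g31; `conjectures/MINE-C.md` §40.8)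

Exploring the cluster of `a₂` one edge at a time (delete the edge, or contract it into `a₂`'s
root) keeps the instance in the class of `(K′)`; the exploration ends when `a₂`'s root has no
edge left, i.e. `a₂` is ISOLATED.  There `Ω = S = univ`, `y ∉ C₂` surely, the class `(1,2)` is
empty, `N = {v ∉ C₁}`, and `(K′)` reads

  `P(v ∉ C₁, y ∈ C₁, b ∈ C₁ ∪ C(v)) · P(v ∉ C₁) ≥ P(b ∈ C₁, v ∉ C₁) · P(v ∉ C₁, y ∈ C₁)`,

the van den Berg–Kahn conditional positive correlation of `a₁ ↔ b` and `a₁ ↔ y` given `a₁ ↮ v`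
(`vdBK_pair`, = BHK06 1.3 one-root with the avoided vertex `v`) plus the non-negative `χ`-mass
`P(v ∉ C₁, y ∈ C₁, b ∉ C₁, b ∈ C(v))`.  So the base case of the induction scheme
«(STEP-K′) ⟹ (K′)» (`MINE-C.md` §40.8) is a theorem; the open step is the one-edge inequality
(STEP-K′).
-/

namespace Summit.Ventures.PercRepro2

namespace KPrime

variable {V : Type*} {E : Type*} [Fintype E] [DecidableEq E] [Fintype V] [DecidableEq V]
  {R : Type*} [Field R] [LinearOrder R] [IsStrictOrderedRing R]

section Isolated

variable {ends : E → Sym2 V}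

omit [Fintype E] [DecidableEq E] [Fintype V] [DecidableEq V] in
/-- An isolated vertex is connected to nothing but itself. -/
lemma eq_of_conn_of_isolated {ω : Config E} {a : V} (hiso : ∀ e, a ∉ ends e) {x : V}
    (h : Conn ends ω a x) : x = a := by
  obtain ⟨w⟩ := h
  cases w with
  | nil => rfl
  | cons hadj _ =>
    exfalso
    rw [openGraph_adj] at hadj
    obtain ⟨_, e, _, hends⟩ := hadj
    exact hiso e (by rw [hends]; exact Sym2.mem_mk_left _ _)

omit [Fintype E] [DecidableEq E] [Fintype V] [DecidableEq V] in
/-- With `a₂` isolated and `a₁ ≠ a₂`, `Ω = {a₁ ↮ a₂}` is everything. -/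
lemma Ω_eq_univ_of_isolated {a₁ a₂ : V} (hiso : ∀ e, a₂ ∉ ends e) (h12 : a₁ ≠ a₂) :
    Ω ends a₁ a₂ = Set.univ := by
  ext ω
  simp only [mem_Ω, Set.mem_univ, iff_true]
  intro h
  exact h12 (eq_of_conn_of_isolated hiso (conn_symm h))

omit [Fintype E] [DecidableEq E] [Fintype V] in
/-- With `a₂` isolated, `a₁ ≠ a₂ ≠ v`, `S = {a₂ ↮ {a₁, v}}` is everything. -/
lemma S_eq_univ_of_isolated {a₁ a₂ v : V} (hiso : ∀ e, a₂ ∉ ends e) (h12 : a₁ ≠ a₂)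
    (hv2 : v ≠ a₂) : S ends a₁ a₂ v = Set.univ := by
  ext ω
  simp only [mem_S, Set.mem_univ, iff_true]
  exact ⟨fun h => h12 (eq_of_conn_of_isolated hiso h), fun h => hv2 (eq_of_conn_of_isolated hiso h)⟩

omit [Fintype E] [DecidableEq E] [Fintype V] in
/-- With `a₂` isolated and `a₁ ≠ a₂`, `N = {a₁ ↮ {a₂, v}}` is `{v ∉ C₁}`. -/
lemma N_eq_of_isolated {a₁ a₂ v : V} (hiso : ∀ e, a₂ ∉ ends e) (h12 : a₁ ≠ a₂) :
    N ends a₁ a₂ v = (connEvent ends a₁ v)ᶜ := by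
  ext ω
  simp only [mem_N, Set.mem_compl_iff, mem_connEvent]
  constructor
  · exact fun h => h.2
  · exact fun h => ⟨fun h' => h12 (eq_of_conn_of_isolated hiso (conn_symm h')), h⟩

omit [Fintype E] [DecidableEq E] [Fintype V] [DecidableEq V] in
/-- With `a₂` isolated and `y ≠ a₂`, `{y ∈ C₂}` is empty. -/
lemma connEvent_eq_empty_of_isolated {a₂ y : V} (hiso : ∀ e, a₂ ∉ ends e) (hy : y ≠ a₂) :
    connEvent ends a₂ y = ∅ := by
  ext ω
  simp only [mem_connEvent, Set.mem_empty_iff_false, iff_false]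
  exact fun h => hy (eq_of_conn_of_isolated hiso h)

end Isolated

section Base

variable (p : E → R) (ends : E → Sym2 V) (a₁ a₂ b v y : V)

/-- **The base case of the `a₂`-frontier induction**: if `a₂` is isolated (`a₁ ≠ a₂`, `v ≠ a₂`,
`y ≠ a₂`), then `(K′)` holds — `0 ≤ kprimeForm … (P(b ∈ C₁, N)) (P(N))`. -/
theorem kprime_of_isolated (hp : IsProbVec p) (hiso : ∀ e, a₂ ∉ ends e) (h12 : a₁ ≠ a₂)
    (hv2 : v ≠ a₂) (hy2 : y ≠ a₂) :
    0 ≤ kprimeForm ends a₁ a₂ b v y p (prob p (connEvent ends a₁ b ∩ N ends a₁ a₂ v))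
      (prob p (N ends a₁ a₂ v)) := by
  have hΩ := Ω_eq_univ_of_isolated (ends := ends) hiso h12
  have hS := S_eq_univ_of_isolated (ends := ends) hiso h12 hv2
  have hN := N_eq_of_isolated (ends := ends) (v := v) hiso h12
  have hY := connEvent_eq_empty_of_isolated (ends := ends) hiso hy2
  unfold kprimeForm cls01e cls01
  rw [hΩ, hS, hN, hY]
  simp only [Set.inter_univ, Set.empty_inter, Set.inter_empty, prob_empty, prob_univ, mul_zero,
    zero_mul, sub_zero, one_mul, zero_add, sub_self]
  -- the remaining claim: P(Uᶜ ∩ W ∩ (X ∪ Cv)) · P(Uᶜ) − P(X ∩ Uᶜ) · P(Uᶜ ∩ W) ≥ 0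
  set U := connEvent ends a₁ v with hU
  set X := connEvent ends a₁ b with hX
  set W := connEvent ends a₁ y with hW
  set Cv := connEvent ends v b with hCv
  have key := vdBK_pair p hp ends a₁ b y v
  -- key : P(X ∩ Uᶜ) · P(W ∩ Uᶜ) ≤ P(X ∩ W ∩ Uᶜ) · P(Uᶜ)
  have hmono : prob p (X ∩ W ∩ Uᶜ) ≤ prob p (Uᶜ ∩ W ∩ (X ∪ Cv)) := by
    apply prob_mono hp
    intro ω hω
    simp only [Set.mem_inter_iff, Set.mem_union, Set.mem_compl_iff] at hω ⊢
    exact ⟨⟨hω.2, hω.1.2⟩, Or.inl hω.1.1⟩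
  have e1 : W ∩ Uᶜ = Uᶜ ∩ W := Set.inter_comm _ _
  rw [e1] at key
  have h0 := prob_nonneg hp Uᶜ
  nlinarith [key, hmono, h0]

end Base

end KPrime

end Summit.Ventures.PercRepro2
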